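import Literature.AlgebraicGeometry.HodgeTheory.NoTypeIVFactorIffCentreTotallyReal
import HarnessLib

/-!
# `L_h^{dim X - 1} h ≠ 0` for every hard Lefschetz class, and Moonen–Zarhin's Lemma (1) (finite half) with
# no auxiliary polarization class among the hypotheses

Layer `Literature/AlgebraicGeometry/HodgeTheory`; THEOREMS ONLY — no definition, no named fact, no `sorry` (D-0026, net
debt 0).  Sequel of the seat's `DivisorLefschetzGroupCentreFiniteIffNoTypeIVFactor` (generation 27, g27-#5/#6) and
`NoTypeIVFactorIffCentreTotallyReal` (g27-#7/#8/#9): there the finite half of Moonen–Zarhin's Lemma (1) («in all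
other cases it is finite») was proved for `X ∼ A^{n+2}` from an AUXILIARY polarization class `h` on `A` — rational, of
type `(1,1)`, hard Lefschetz, Hodge–Riemann positive on `H^{1,0}` (the output of the tree's
`HodgeGroupSemisimple.exists_polarizationClass`) — together with ONE MORE hypothesis `L_h^{dim A - 1} h ≠ 0` that the
tree's package does not deliver.  §1 of this file derives that hypothesis from the hard Lefschetz property alone
(`L^{dim} : H⁰ → H^{2 dim}` is injective and `L^{dim} 1 = L^{dim-1} h` up to degree transport; `1 ≠ 0` in
`H⁰(X(ℂ); ℂ)` for `X` smooth projective), §2 completes the polarization-class package (one `∃` with all seven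
conjuncts the seat's Moonen–Zarhin files consume), and §3 restates the finite half of Lemma (1) INTRINSICALLY: for
`B` simple without factor of type IV (equivalently with totally real centre `E` of `End⁰(B)`), for every `X`
isogenous to `B^{n+2}` and every admissible `h_X`, the centre of `G_div(X)(h_X)(ℂ)` is a finite `2`-group of order
`≤ 2^{[E:ℚ]}` — no class on `B` is mentioned in the statement any more; likewise for a general `A` with the
`End(A)`-level presentation of the centre.

## The print

C. Voisin, *Hodge Theory and Complex Algebraic Geometry I* (2002) [VoisinHodgeI2002], §6.2.3 Thm. 6.25 (hard
Lefschetz: `L^{n-k} : H^k(X, ℝ) → H^{2n-k}(X, ℝ)` is an isomorphism) and §3.1.3 Cor. 3.9 (for `X` compact Kähler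
`ω^n ≠ 0` in `H^{2n}`, indeed `L^k` is injective on `H⁰` for `k ≤ n`); P. Griffiths, J. Harris, *Principles*
(1978) p. 122 (the same); A. Hatcher, *Algebraic Topology* (2002) [HatcherAT2002] §3.2 p. 211 (`1 ⌣ a = a = a ⌣ 1`).
B. J. J. Moonen, Yu. G. Zarhin, *Weil classes on abelian varieties*, J. reine angew. Math. **496** (1998) 83–92 =
arXiv:alg-geom/9612017 [MoonenZarhin1998WeilClasses] (held text `paper:arxiv-alg-geom_9612017`), §1 Lemma (1)
(chunk p0002 L121–L127), VERBATIM: «(1) The center of `G_div(X)` is the group `U_{K_B}` given by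
`U_{K_B}(R) = {a ∈ (K_B ⊗_ℚ R)^* | a a† = 1}`. For `X` of type 4 with either `d ≥ 2` or `m ≥ 2` this is a connected
torus of rank `e₀`; in all other cases it is finite.»

## What is proved (sorry-free)

§1 `1 ≠ 0` AND THE TOP POWER OF A HARD LEFSCHETZ CLASS:
* `singularCohomology_one_ne_zero_of_isSmoothProjective` — `1 ≠ 0` in `H⁰(X(ℂ); ℂ)` for `X` smooth projective
  (`H⁰` is a line, `finrank_complexBetti_zero`; were `1 = 0`, `a = a ⌣ 1 = 0` for every `a`);
* **`lefschetzPow_self_ne_zero_of_hasHardLefschetzProperty`** — `1 ≠ 0`, `HasHardLefschetzProperty κ d`, `1 ≤ d` ⟹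
  `L_κ^{d-1} κ ≠ 0`; `…_of_isSmoothProjective`; **`AbelianVariety.lefschetzPow_self_ne_zero_of_hasHardLefschetzProperty`**
  (`1 ≤ dim A`, `HasHardLefschetzProperty h (dim A)` ⟹ `L_h^{dim A - 1} h ≠ 0`).
§2 THE POLARIZATION-CLASS PACKAGE, COMPLETE:
* `mem_hodgeClassSpan_one_of_isRationalClass_of_isOfHodgeType` — a rational `(1,1)`-class lies in `B¹(A) ⊗ ℂ`;
* **`AbelianVariety.exists_polarizationClass_package`** — `1 ≤ dim A` ⟹ `∃ h`: rational, `(1,1)`, hard Lefschetz,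
  Hodge–Riemann positive on `H^{1,0}`, `h ∈ B¹ ⊗ ℂ`, `L_h^{dim A - 1} h ≠ 0`, `Q_h` non-degenerate on `H¹`.
§3 LEMMA (1), FINITE HALF, INTRINSIC FORMS (no class on the base among the hypotheses):
* **`HasNoTypeIVFactor.center_divisorLefschetzGroup_involutive_finite_card_le_of_isIsogenous_biproduct_two`** —
  `A` with the `End(A)`-level presentation of the centre (`ψ` central, `R(ψ) = 0` irreducible over `ℚ`, every central
  `g` with `N g ∈ ℤ[ψ]`) and no factor of type IV, `X ∼ A^{n+2}`, `h_X` admissible ⟹ the centre of `G_div(X)(h_X)(ℂ)`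
  consists of involutions, is finite, of order `≤ 2^{deg R}`; `HasNoTypeIVFactor.finite_center_divisorLefschetzGroup_…`;
* **`AbelianVariety.IsSimple.center_divisorLefschetzGroup_involutive_finite_card_le_of_hasNoTypeIVFactor`**,
  `….of_isTotallyReal_centerField`, `AbelianVariety.IsSimple.finite_center_divisorLefschetzGroup_of_hasNoTypeIVFactor`,
  `…_of_isTotallyReal_centerField` — `B` simple of positive dimension with `HasNoTypeIVFactor B`, resp.
  `IsTotallyReal (CenterField B)`, `X ∼ B^{n+2}`, `h_X` admissible ⟹ the same with the bound `2^{[E:ℚ]}`;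
* `hasNoTypeIVFactor_iff_pullbackOne_symm_of_centre_End'` (the seat's g27 criterion «no factor of type IV iff the
  central generator is `Q_h`-symmetric» with the package's `h`, i.e. an `∃ h` form), for completeness.

## Honest column

* The torus half of Lemma (1) («type 4 … a connected torus») and the `Finite ↔ HasNoTypeIVFactor` dichotomy still
  carry the Rosati image `ψ'` of the central generator among their hypotheses (see the module docstring of
  `NoTypeIVFactorIffCentreTotallyReal`); they are not restated here.
* `1 ≠ 0` in `H⁰` is taken from `finrank_complexBetti_zero` (the tree's «`X(ℂ)` is connected» for smooth projective
  `X`); the general-topology form for a non-empty space is the tree's `singularCohomology_one_ne_zero`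
  (`AbsoluteHodgeClassesDegreeZero`), outside this file's import cone, whence the hypothesis `h1 : 1 ≠ 0` in the
  general §1 lemma.

## Provenance

Lane `lit-hodgefound` (Track 2, Layer A), prover seat `lit-hodgefound-p21` (generation 28), row g28-#1; successor note
(b) of the seat's generation 27.
-/

noncomputable section

open CategoryTheory CategoryTheory.Limits Polynomial Module NumberField
open Literature.AlgebraicTopology.SingularHomology
open Literature.AlgebraicGeometry.Motives
open Literature.AlgebraicGeometry.VanGeemen1994 (hodgeClassSpan pullbackOne)
open Literature.AlgebraicGeometry.Milne1999
open Literature.AlgebraicGeometry.ComplexMultiplication (CenterField)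
open Literature.Geometry.Kaehler (lefschetzPow HasHardLefschetzProperty)

namespace Literature.AlgebraicGeometry.HodgeTheory

/-! ### §1 `1 ≠ 0` in `H⁰(X(ℂ); ℂ)` and the top power of a hard Lefschetz class -/

section TopPower

variable {X : SchemeOver ℂ} {n : ℕ}

/-- **`1 ≠ 0` in `H⁰(X(ℂ); ℂ)`** for `X` smooth projective over `ℂ`: `H⁰(X(ℂ); ℂ)` is a line
(`finrank_complexBetti_zero`), and `1 = 0` would force `a = a ⌣ 1 = 0` for every class `a`.
[cite: HatcherAT2002, §3.2 p. 211 and §3.1 p. 199] -/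
theorem singularCohomology_one_ne_zero_of_isSmoothProjective (hX : IsSmoothProjective n X) :
    singularCohomology.one ℂ (ComplexPoints X) ≠ 0 := by
  intro h0
  have hsub : Subsingleton (complexBetti X 0) := by
    refine ⟨fun a b ↦ ?_⟩
    rw [← cupProduct_one (R := ℂ) (X := ComplexPoints X) a, ← cupProduct_one (R := ℂ) (X := ComplexPoints X) b,
      h0, map_zero, map_zero]
  have h1 := finrank_complexBetti_zero hX
  rw [Module.finrank_zero_of_subsingleton] at h1
  exact zero_ne_one h1

/-- **THE TOP POWER OF A HARD LEFSCHETZ CLASS IS NON-ZERO: `L_κ^{d-1} κ ≠ 0`** in `H^{2d}(X(ℂ); ℂ)` whenever `κ` has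
the hard Lefschetz property in dimension `d ≥ 1` and `1 ≠ 0` in `H⁰(X(ℂ); ℂ)`: `L_κ^d : H⁰ → H^{2d}` is bijective,
in particular injective (`injective_lefschetzPow_zero_of_hasHardLefschetzProperty`), and `L_κ^d 1 = L_κ^{d-1} κ` up
to the degree transport `2 + 2(d-1) = 0 + 2d` (`lefschetzPow_succ_one_eq_degCast`, from `κ ⌣ 1 = κ`).  This is the
hypothesis `htop` of the seat's Moonen–Zarhin files, now a consequence of `HasHardLefschetzProperty`.
[cite: VoisinHodgeI2002, §6.2.3 Thm. 6.25 and §3.1.3 Cor. 3.9] [cite: HatcherAT2002, §3.2 p. 211] -/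
theorem lefschetzPow_self_ne_zero_of_hasHardLefschetzProperty {κ : complexBetti X 2} {d : ℕ}
    (h1 : singularCohomology.one ℂ (ComplexPoints X) ≠ 0) (hκ : HasHardLefschetzProperty κ d) (hd : 1 ≤ d) :
    lefschetzPow κ (d - 1) 2 κ ≠ 0 := by
  obtain ⟨j, rfl⟩ := Nat.exists_eq_add_of_le' hd
  rw [Nat.add_sub_cancel]
  intro h0
  have h := lefschetzPow_succ_one_eq_degCast κ j
  rw [h0, map_zero] at h
  exact (map_ne_zero_iff _ (injective_lefschetzPow_zero_of_hasHardLefschetzProperty κ hκ le_rfl)).2 h1 h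

/-- **`L_κ^{d-1} κ ≠ 0` for a hard Lefschetz class `κ` in dimension `d ≥ 1` on a smooth projective `X`.**
[cite: VoisinHodgeI2002, §6.2.3 Thm. 6.25 and §3.1.3 Cor. 3.9] -/
theorem lefschetzPow_self_ne_zero_of_hasHardLefschetzProperty_of_isSmoothProjective (hX : IsSmoothProjective n X)
    {κ : complexBetti X 2} {d : ℕ} (hκ : HasHardLefschetzProperty κ d) (hd : 1 ≤ d) :
    lefschetzPow κ (d - 1) 2 κ ≠ 0 :=
  lefschetzPow_self_ne_zero_of_hasHardLefschetzProperty (singularCohomology_one_ne_zero_of_isSmoothProjective hX) hκ hd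

end TopPower

/-! ### §2 The polarization-class package of a complex abelian variety, complete -/

section Package

variable {A : AbelianVariety ℂ} {h : complexBetti A.X 2}

/-- **`L_h^{dim A - 1} h ≠ 0` for every hard Lefschetz class `h` on a positive-dimensional complex abelian variety**
(the hypothesis `htop` of the seat's Moonen–Zarhin files, DISCHARGED from `HasHardLefschetzProperty h (dim A)`).
[cite: VoisinHodgeI2002, §6.2.3 Thm. 6.25 and §3.1.3 Cor. 3.9] [cite: LangeBirkenhake1992, §4.10 (Riemann–Roch, `(L^g) = g! · χ(L)`)] -/
theorem _root_.Literature.AlgebraicGeometry.Motives.AbelianVariety.lefschetzPow_self_ne_zero_of_hasHardLefschetzProperty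
    (h1 : 1 ≤ A.dim) (hHL : HasHardLefschetzProperty h A.dim) : lefschetzPow h (A.dim - 1) 2 h ≠ 0 :=
  lefschetzPow_self_ne_zero_of_hasHardLefschetzProperty_of_isSmoothProjective
    (AbelianVariety.isSmoothProjective_holds (A := A)) hHL h1

/-- A rational `(1,1)`-class lies in `B¹(A) ⊗ ℂ = hodgeClassSpan A 1` (it is one of the spanning classes).
[cite: VoisinHodgeI2002, §7.1.2 and §11.3.2] -/
theorem mem_hodgeClassSpan_one_of_isRationalClass_of_isOfHodgeType (hQ : IsRationalClass h)
    (h11 : IsOfHodgeType A.dim A.X 2 1 1 h) : h ∈ hodgeClassSpan A.dim A.X 1 :=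
  Submodule.subset_span
    (show h ∈ {c : complexBetti A.X (2 * 1) | IsRationalClass c ∧ IsOfHodgeType A.dim A.X (2 * 1) 1 1 c}
      from ⟨hQ, h11⟩)

/-- **THE POLARIZATION-CLASS PACKAGE of a positive-dimensional complex abelian variety, COMPLETE**: there is a class
`h ∈ H²(A(ℂ); ℂ)` which is rational, of Hodge type `(1,1)`, has the hard Lefschetz property in dimension `dim A`,
is Hodge–Riemann positive on `H^{1,0}` (`Q_h(x, x̄) ≠ 0` for `x ≠ 0` of type `(1,0)`), lies in `B¹(A) ⊗ ℂ`, has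
`L_h^{dim A - 1} h ≠ 0`, and whose polarization pairing `Q_h = h^{dim A - 1} ⌣ (· ⌣ ·)` on `H¹(A(ℂ); ℂ)` is
non-degenerate — the hyperplane class of a projective embedding (the tree's `HodgeGroupSemisimple.exists_polarizationClass`,
Voisin I Thm. 6.25 / Thm. 6.32 / §7.1.2) with §1 and the tree's
`Milne1999.eq_zero_of_forall_polarizationPairingOne_eq_zero_of_hasHardLefschetzProperty`.
[cite: VoisinHodgeI2002, Thm. 6.25, Thm. 6.32, §7.1.2 and §3.1.3 Cor. 3.9] [cite: vanGeemen1994HodgeAV, Lemma 5.2 (1)]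
[cite: Milne1999LefschetzClasses, §1 p. 642 (e_D non-degenerate for D ample)] -/
theorem _root_.Literature.AlgebraicGeometry.Motives.AbelianVariety.exists_polarizationClass_package (h1 : 1 ≤ A.dim) :
    ∃ h : complexBetti A.X 2, IsRationalClass h ∧ IsOfHodgeType A.dim A.X 2 1 1 h ∧
      HasHardLefschetzProperty h A.dim ∧
      (∀ x ∈ hodgeOneZero (AbelianVariety.isSmoothProjective_holds (A := A)), x ≠ 0 →
        polarizationPairingOne A.X h (A.dim - 1) x (conjClass (ComplexPoints A.X) 1 x) ≠ 0) ∧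
      h ∈ hodgeClassSpan A.dim A.X 1 ∧ lefschetzPow h (A.dim - 1) 2 h ≠ 0 ∧
      ∀ x : complexBetti A.X 1, (∀ y, polarizationPairingOne A.X h (A.dim - 1) x y = 0) → x = 0 := by
  obtain ⟨h, hQ, h11, hHL, hposQ⟩ := HodgeGroupSemisimple.exists_polarizationClass (A := A) h1
  exact ⟨h, hQ, h11, hHL, hposQ, mem_hodgeClassSpan_one_of_isRationalClass_of_isOfHodgeType hQ h11,
    AbelianVariety.lefschetzPow_self_ne_zero_of_hasHardLefschetzProperty h1 hHL,
    fun _ hx ↦ eq_zero_of_forall_polarizationPairingOne_eq_zero_of_hasHardLefschetzProperty h1 hHL hx⟩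

end Package

/-! ### §3 Lemma (1), «in all other cases it is finite», with no auxiliary class on the base -/

section Presented

variable {A : AbelianVariety ℂ} {n : ℕ} {ψ : A ⟶ A} {R : Polynomial ℤ}

/-- **MOONEN–ZARHIN LEMMA (1), FINITE HALF, `m ≥ 2`, INTRINSIC FORM for the `End(A)`-level presentation of the
centre**: if the centre of `End⁰(A)` is `ℚ(ψ)` on `End(A)` (`ψ` central, `R(ψ) = 0` with `R ∈ ℤ[X]` irreducible
over `ℚ`, every central `g` with `N g ∈ ℤ[ψ]`, `dim A ≥ 1`) and `A` has no factor of type IV, then for every `X`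
isogenous to `A^{n+2}` and every admissible `h_X` (in `B¹(X) ⊗ ℂ` with `Q_{h_X}` non-degenerate) every central element
of `G_div(X)(h_X)(ℂ)` is an involution and the centre is finite of order `≤ 2^{deg R}` — the seat's
`center_divisorLefschetzGroup_involutive_finite_card_le_of_hasNoTypeIVFactor_of_isIsogenous_biproduct_two` fed with
the package of §2 («in all other cases it is finite»; `U_E = μ₂^{Σ_E}` for `E` totally real).
[cite: MoonenZarhin1998WeilClasses, §1 Lemma (1) (chunk p0002 L121–L127) with §1 (chunk p0002 L45–L51)]
[cite: Lange2023AbelianVarietiesC, §2.6 (Lemma 2.6.4, held p0144)] [cite: Milne1999LefschetzClasses, §2 pp. 645–651] -/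
theorem HasNoTypeIVFactor.center_divisorLefschetzGroup_involutive_finite_card_le_of_isIsogenous_biproduct_two
    (h4 : HasNoTypeIVFactor A) (h1 : 1 ≤ A.dim) (hψ : ∀ χ : A ⟶ A, ψ ≫ χ = χ ≫ ψ)
    (hRirr : Irreducible (R.map (Int.castRingHom ℚ)))
    (hψR : Polynomial.eval₂ (Int.castRingHom (CategoryTheory.End A)) (ψ : CategoryTheory.End A) R = 0)
    (hZ : ∀ g : A ⟶ A, (∀ χ : A ⟶ A, g ≫ χ = χ ≫ g) →
      ∃ N : ℤ, N ≠ 0 ∧ End.of (N • g) ∈ Subring.closure {End.of ψ})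
    {X : AbelianVariety ℂ} (hX : AbelianVariety.IsIsogenous X (⨁ (fun _ : Fin (n + 2) => A)))
    {hX' : complexBetti X.X 2} (hhX : hX' ∈ hodgeClassSpan X.dim X.X 1)
    (hndX : ∀ x : complexBetti X.X 1, (∀ y, polarizationPairingOne X.X hX' (X.dim - 1) x y = 0) → x = 0) :
    (∀ z ∈ Subgroup.center (divisorLefschetzGroup X hX'), z * z = 1) ∧
      Finite (Subgroup.center (divisorLefschetzGroup X hX')) ∧
      Nat.card (Subgroup.center (divisorLefschetzGroup X hX')) ≤ 2 ^ R.natDegree := by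
  obtain ⟨h, hQ, h11, hHL, hposQ, -, htop, -⟩ := AbelianVariety.exists_polarizationClass_package (A := A) h1
  exact center_divisorLefschetzGroup_involutive_finite_card_le_of_hasNoTypeIVFactor_of_isIsogenous_biproduct_two h1 hQ
    h11 hHL hposQ htop hψ hRirr hψR hZ h4 hX hhX hndX

/-- **… in particular the centre of `G_div(X)(h_X)(ℂ)` is finite** for every `X ∼ A^{n+2}`, `A` presented and without
factor of type IV. [cite: MoonenZarhin1998WeilClasses, §1 Lemma (1) (chunk p0002 L121–L127)] [cite: MoonenZarhin1999LowDim, §1] -/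
theorem HasNoTypeIVFactor.finite_center_divisorLefschetzGroup_of_isIsogenous_biproduct_two
    (h4 : HasNoTypeIVFactor A) (h1 : 1 ≤ A.dim) (hψ : ∀ χ : A ⟶ A, ψ ≫ χ = χ ≫ ψ)
    (hRirr : Irreducible (R.map (Int.castRingHom ℚ)))
    (hψR : Polynomial.eval₂ (Int.castRingHom (CategoryTheory.End A)) (ψ : CategoryTheory.End A) R = 0)
    (hZ : ∀ g : A ⟶ A, (∀ χ : A ⟶ A, g ≫ χ = χ ≫ g) →
      ∃ N : ℤ, N ≠ 0 ∧ End.of (N • g) ∈ Subring.closure {End.of ψ})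
    {X : AbelianVariety ℂ} (hX : AbelianVariety.IsIsogenous X (⨁ (fun _ : Fin (n + 2) => A)))
    {hX' : complexBetti X.X 2} (hhX : hX' ∈ hodgeClassSpan X.dim X.X 1)
    (hndX : ∀ x : complexBetti X.X 1, (∀ y, polarizationPairingOne X.X hX' (X.dim - 1) x y = 0) → x = 0) :
    Finite (Subgroup.center (divisorLefschetzGroup X hX')) :=
  (h4.center_divisorLefschetzGroup_involutive_finite_card_le_of_isIsogenous_biproduct_two h1 hψ hRirr hψR hZ hX hhX
    hndX).2.1

/-- **`A` HAS NO FACTOR OF TYPE IV iff SOME POLARIZATION CLASS MAKES THE CENTRAL GENERATOR `Q_h`-SYMMETRIC** — the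
seat's criterion `hasNoTypeIVFactor_iff_pullbackOne_symm_of_centre_End` (`h` rational, `(1,1)`, hard Lefschetz,
Hodge–Riemann positive) in `∃ h` form, the class supplied by §2 (`dim A ≥ 1`; `ψ` central with `R(ψ) = 0`, `R` monic
irreducible over `ℚ`, every central `g` with `N g ∈ ℤ[ψ]`).
[cite: Lange2023AbelianVarietiesC, §2.6 (first/second kind; Lemma 2.6.4, Lemma 2.6.6, held p0144)]
[cite: LangeBirkenhake1992, §5.5] [cite: MoonenZarhin1999LowDim, §1] -/
theorem hasNoTypeIVFactor_iff_exists_pullbackOne_symm_of_centre_End (h1 : 1 ≤ A.dim)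
    (hψ : ∀ χ : A ⟶ A, ψ ≫ χ = χ ≫ ψ) (hRm : R.Monic) (hRirr : Irreducible (R.map (Int.castRingHom ℚ)))
    (hψR : Polynomial.eval₂ (Int.castRingHom (CategoryTheory.End A)) (ψ : CategoryTheory.End A) R = 0)
    (hZ : ∀ g : A ⟶ A, (∀ χ : A ⟶ A, g ≫ χ = χ ≫ g) →
      ∃ N : ℤ, N ≠ 0 ∧ End.of (N • g) ∈ Subring.closure {End.of ψ}) :
    HasNoTypeIVFactor A ↔ ∃ h : complexBetti A.X 2, IsRationalClass h ∧ IsOfHodgeType A.dim A.X 2 1 1 h ∧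
      HasHardLefschetzProperty h A.dim ∧
      (∀ x ∈ hodgeOneZero (AbelianVariety.isSmoothProjective_holds (A := A)), x ≠ 0 →
        polarizationPairingOne A.X h (A.dim - 1) x (conjClass (ComplexPoints A.X) 1 x) ≠ 0) ∧
      ∀ x y : complexBetti A.X 1, polarizationPairingOne A.X h (A.dim - 1) (pullbackOne A ψ x) y =
        polarizationPairingOne A.X h (A.dim - 1) x (pullbackOne A ψ y) := by
  obtain ⟨h, hQ, h11, hHL, hposQ, -, -, -⟩ := AbelianVariety.exists_polarizationClass_package (A := A) h1
  refine ⟨fun h4 ↦ ⟨h, hQ, h11, hHL, hposQ,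
    (hasNoTypeIVFactor_iff_pullbackOne_symm_of_centre_End h1 hQ h11 hHL hposQ hψ hRm hRirr hψR hZ).1 h4⟩, ?_⟩
  rintro ⟨h', hQ', h11', hHL', hposQ', hsym⟩
  exact (hasNoTypeIVFactor_iff_pullbackOne_symm_of_centre_End h1 hQ' h11' hHL' hposQ' hψ hRm hRirr hψR hZ).2 hsym

end Presented

section Simple

variable {B : AbelianVariety ℂ} {n : ℕ}

/-- **MOONEN–ZARHIN LEMMA (1), FINITE HALF, FOR `X ∼ Y^m` WITH `Y` SIMPLE OF TYPES 1–3 (`m ≥ 2`) — INTRINSIC FORM**: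
for `B` simple of positive dimension with `HasNoTypeIVFactor B`, every `X` isogenous to `B^{n+2}` and every
admissible `h_X`, the central elements of `G_div(X)(h_X)(ℂ)` are involutions and the centre is finite of order
`≤ 2^{[E:ℚ]}`, `E = CenterField B` the centre of `End⁰(B)`.  NO polarization class of `B` among the hypotheses: the
auxiliary class of the seat's `center_divisorLefschetzGroup_involutive_finite_card_le_of_isSimple_of_hasNoTypeIVFactor`
is the package of §2.  («… in all other cases it is finite»; `U_E = μ₂^{Σ_E}`.)
[cite: MoonenZarhin1998WeilClasses, §1 Lemma (1) (chunk p0002 L121–L127) with §1 (chunk p0002 L45–L51)]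
[cite: MumfordAV1970, §19 Thm. 3 and Cor. 2 of Thm. 1] [cite: Milne1999LefschetzClasses, §2 pp. 645–651] -/
theorem _root_.Literature.AlgebraicGeometry.Motives.AbelianVariety.IsSimple.center_divisorLefschetzGroup_involutive_finite_card_le_of_hasNoTypeIVFactor
    (hB : AbelianVariety.IsSimple B) (h1 : 1 ≤ B.dim) (h4 : HasNoTypeIVFactor B)
    {X : AbelianVariety ℂ} (hX : AbelianVariety.IsIsogenous X (⨁ (fun _ : Fin (n + 2) => B)))
    {hX' : complexBetti X.X 2} (hhX : hX' ∈ hodgeClassSpan X.dim X.X 1)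
    (hndX : ∀ x : complexBetti X.X 1, (∀ y, polarizationPairingOne X.X hX' (X.dim - 1) x y = 0) → x = 0) :
    (∀ z ∈ Subgroup.center (divisorLefschetzGroup X hX'), z * z = 1) ∧
      Finite (Subgroup.center (divisorLefschetzGroup X hX')) ∧
      Nat.card (Subgroup.center (divisorLefschetzGroup X hX')) ≤ 2 ^ Module.finrank ℚ (CenterField B hB h1) := by
  obtain ⟨h, hQ, h11, hHL, hposQ, -, htop, -⟩ := AbelianVariety.exists_polarizationClass_package (A := B) h1
  exact center_divisorLefschetzGroup_involutive_finite_card_le_of_isSimple_of_hasNoTypeIVFactor hB h1 hQ h11 hHL hposQ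
    htop h4 hX hhX hndX

/-- **… FOR `B` SIMPLE WITH TOTALLY REAL CENTRE** (`IsTotallyReal (CenterField B)` — types 1–3 as the print defines
them), intrinsic form. [cite: MoonenZarhin1998WeilClasses, §1 Lemma (1) (chunk p0002 L121–L127) with §1 (chunk p0002 L45–L51)]
[cite: LangeBirkenhake1992, §5.5] [cite: Shimura1998, §5.1 Proposition 5 (p. 36)] -/
theorem _root_.Literature.AlgebraicGeometry.Motives.AbelianVariety.IsSimple.center_divisorLefschetzGroup_involutive_finite_card_le_of_isTotallyReal_centerField
    (hB : AbelianVariety.IsSimple B) (h1 : 1 ≤ B.dim) (hK : IsTotallyReal (CenterField B hB h1))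
    {X : AbelianVariety ℂ} (hX : AbelianVariety.IsIsogenous X (⨁ (fun _ : Fin (n + 2) => B)))
    {hX' : complexBetti X.X 2} (hhX : hX' ∈ hodgeClassSpan X.dim X.X 1)
    (hndX : ∀ x : complexBetti X.X 1, (∀ y, polarizationPairingOne X.X hX' (X.dim - 1) x y = 0) → x = 0) :
    (∀ z ∈ Subgroup.center (divisorLefschetzGroup X hX'), z * z = 1) ∧
      Finite (Subgroup.center (divisorLefschetzGroup X hX')) ∧
      Nat.card (Subgroup.center (divisorLefschetzGroup X hX')) ≤ 2 ^ Module.finrank ℚ (CenterField B hB h1) :=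
  hB.center_divisorLefschetzGroup_involutive_finite_card_le_of_hasNoTypeIVFactor h1
    ((hasNoTypeIVFactor_iff_isTotallyReal_centerField hB h1).2 hK) hX hhX hndX

/-- **… in particular `Z(G_div(X)(h_X))(ℂ)` is finite** for every `X ∼ B^{n+2}`, `B` simple without factor of type
IV — intrinsic form. [cite: MoonenZarhin1998WeilClasses, §1 Lemma (1) (chunk p0002 L121–L127)] [cite: MoonenZarhin1999LowDim, §1] -/
theorem _root_.Literature.AlgebraicGeometry.Motives.AbelianVariety.IsSimple.finite_center_divisorLefschetzGroup_of_hasNoTypeIVFactor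
    (hB : AbelianVariety.IsSimple B) (h1 : 1 ≤ B.dim) (h4 : HasNoTypeIVFactor B)
    {X : AbelianVariety ℂ} (hX : AbelianVariety.IsIsogenous X (⨁ (fun _ : Fin (n + 2) => B)))
    {hX' : complexBetti X.X 2} (hhX : hX' ∈ hodgeClassSpan X.dim X.X 1)
    (hndX : ∀ x : complexBetti X.X 1, (∀ y, polarizationPairingOne X.X hX' (X.dim - 1) x y = 0) → x = 0) :
    Finite (Subgroup.center (divisorLefschetzGroup X hX')) :=
  (hB.center_divisorLefschetzGroup_involutive_finite_card_le_of_hasNoTypeIVFactor h1 h4 hX hhX hndX).2.1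

/-- **… and for `B` simple with totally real centre** — intrinsic form.
[cite: MoonenZarhin1998WeilClasses, §1 Lemma (1) (chunk p0002 L121–L127)] [cite: LangeBirkenhake1992, §5.5] -/
theorem _root_.Literature.AlgebraicGeometry.Motives.AbelianVariety.IsSimple.finite_center_divisorLefschetzGroup_of_isTotallyReal_centerField
    (hB : AbelianVariety.IsSimple B) (h1 : 1 ≤ B.dim) (hK : IsTotallyReal (CenterField B hB h1))
    {X : AbelianVariety ℂ} (hX : AbelianVariety.IsIsogenous X (⨁ (fun _ : Fin (n + 2) => B)))
    {hX' : complexBetti X.X 2} (hhX : hX' ∈ hodgeClassSpan X.dim X.X 1)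
    (hndX : ∀ x : complexBetti X.X 1, (∀ y, polarizationPairingOne X.X hX' (X.dim - 1) x y = 0) → x = 0) :
    Finite (Subgroup.center (divisorLefschetzGroup X hX')) :=
  (hB.center_divisorLefschetzGroup_involutive_finite_card_le_of_isTotallyReal_centerField h1 hK hX hhX hndX).2.1

/-- **The same bound `2^{[E:ℚ]}` for the powers `B^{n+2}` themselves** (`X = ⨁_{Fin (n+2)} B`), with any admissible
class. [cite: MoonenZarhin1998WeilClasses, §1 Lemma (1) (chunk p0002 L121–L127)] [cite: MoonenZarhin1999LowDim, §1] -/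
theorem _root_.Literature.AlgebraicGeometry.Motives.AbelianVariety.IsSimple.center_divisorLefschetzGroup_biproduct_involutive_finite_card_le_of_hasNoTypeIVFactor
    (hB : AbelianVariety.IsSimple B) (h1 : 1 ≤ B.dim) (h4 : HasNoTypeIVFactor B)
    {hX' : complexBetti (⨁ (fun _ : Fin (n + 2) => B)).X 2}
    (hhX : hX' ∈ hodgeClassSpan (⨁ (fun _ : Fin (n + 2) => B)).dim (⨁ (fun _ : Fin (n + 2) => B)).X 1)
    (hndX : ∀ x : complexBetti (⨁ (fun _ : Fin (n + 2) => B)).X 1,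
      (∀ y, polarizationPairingOne (⨁ (fun _ : Fin (n + 2) => B)).X hX' ((⨁ (fun _ : Fin (n + 2) => B)).dim - 1) x y =
        0) → x = 0) :
    (∀ z ∈ Subgroup.center (divisorLefschetzGroup (⨁ (fun _ : Fin (n + 2) => B)) hX'), z * z = 1) ∧
      Finite (Subgroup.center (divisorLefschetzGroup (⨁ (fun _ : Fin (n + 2) => B)) hX')) ∧
      Nat.card (Subgroup.center (divisorLefschetzGroup (⨁ (fun _ : Fin (n + 2) => B)) hX')) ≤
        2 ^ Module.finrank ℚ (CenterField B hB h1) :=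
  hB.center_divisorLefschetzGroup_involutive_finite_card_le_of_hasNoTypeIVFactor h1 h4 (AbelianVariety.IsIsogenous.refl _)
    hhX hndX

end Simple

end Literature.AlgebraicGeometry.HodgeTheory

end
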